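import Summits.CriticalPhenomena.PercolationContinuityZ3.Theorems.PercNearOneGluingNoHeavyLowerTailOneCutFiveZeroOne
import Summits.CriticalPhenomena.PercolationContinuityZ3.Theorems.PercNearOneGluingNoHeavyLowerTailOfAnchoredUnionTransfer
import HarnessLib

/-!
# `NoHeavyLowerTail` (stmt-CriticalPhenomena-4575) — the `|A| = 5` one-cut rung from THREE named pieces:
# `Z(3,2)` (four points, the glued half), `AUT(|W| = 4)` (⟹ `CIL₂(5)`), and the two-finger bound OFF the observer

Support file (prover seat `prim-a5-assembly-2`, gen 2; `--supports stmt-CriticalPhenomena-4575`; memo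
`run/shared/lean/prim/prim-a5/ASSEMBLY.md` §10).  No definitions, no named facts, no sorries; every hypothesis is written
verbatim in the binder shape of the tree lemma it instantiates.

`μ = prodBernoulli w` on `Fin n`, relay set `A` with `A.card = 5`, observer `o`, `N = #{x ∈ A : o ↔ x}`, block
`T_a = {x ∈ A : a ↔ x}`; "light `v`" = `2·#T_v ≤ |A|` (= `#T_v ≤ 2` at `|A| = 5`).

* `OneCutFive.cil25_of_lightestRelayTransfer5` — the `A.card = 5` instance of gen-induct's lightest-relay transfer
  (`AnchoredUnionTransfer.lightestRelayTransfer_imp_cumulativeIsolation`, one graph at a time) gives assembly-1's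
  `OneCutFive.CIL25`: for `o ∉ A` and `a` a relay maximising `μ(light a)`, the transfer
  `μ(o ↮ a, o ↔ A∖a, light o) ≤ μ(o ↮ a, light a)` yields `μ{1 ≤ N ≤ 2} ≤ μ{#T_a ≤ 2}`.
* `OneCutFive.cil25_of_anchoredUnionTransfer5` — the same from the ANCHORED UNION TRANSFER `AUT(|W| = 4)`
  (right-hand side `μ(o ↮ a, o ↔ A∖a, light a)`), the `|A| = 5` rung of the AUT ladder (`|W| ≤ 2` are theorems).
* `OneCutFive.oneCut5_of_twoFingerHub_of_anchoredUnionTransfer5` — `X′(5) ∧ AUT(|W| = 4) ⟹ oneCut(5)`.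
* `OneCutFive.oneCut5_of_zeroOneThree_of_cil25_of_twoFingerOff` — the rung from the three pieces that are exactly
  what is open: `Z(3,2)` (assembly-1's `ZeroOneThree`, four points: the `o ∈ A` half via `oneCut5_at_of_mem_of_zeroOneThree`),
  `CIL₂(5)`, and the two-finger bound at relays `a` for observers `o ∉ A` only ("`X′_off`", six points).
HONEST LABEL: toward `|A| = 5` of the one-arm near-critical percolation programme (crux 4575); `Z(3,2)`, `AUT(|W| = 4)`,
`CIL₂(5)`, `X′(5)` are OPEN (census-validated, no certificate); nothing here asserts them or the crux; SHK3⁺/E1/E3GRP are not used.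
-/

noncomputable section

namespace Summit.CriticalPhenomena.PercolationContinuityZ3.Theorems

open MeasureTheory Set Literature.Probability.LatticeModels Literature.Probability.Percolation
open scoped Classical BigOperators

namespace OneCutFive

variable {n : ℕ}

/-- At `|A| = 5`, "light" (`2·#T ≤ |A|`) is `#T ≤ 2`, for the observer's minority event. [this work] -/
theorem minority_set_eq_of_card_five (A : Finset (Fin n)) (o : Fin n) (hA : A.card = 5) :
    {ω : BondConfig (Fin n) | 1 ≤ (A.filter fun x => ω ∈ openConn o x).card ∧
        (A.filter fun x => ω ∈ openConn o x).card ≤ 2} =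
      {ω : BondConfig (Fin n) | 1 ≤ (A.filter fun x => ω ∈ openConn o x).card ∧
        2 * (A.filter fun x => ω ∈ openConn o x).card ≤ A.card} := by
  ext ω
  simp only [Set.mem_setOf_eq, hA]
  omega

/-- At `|A| = 5`, "light `a`" (`2·#T_a ≤ |A|`) is `#T_a ≤ 2`. [this work] -/
theorem light_set_eq_of_card_five (A : Finset (Fin n)) (a : Fin n) (hA : A.card = 5) :
    {ω : BondConfig (Fin n) | (A.filter fun x => ω ∈ openConn a x).card ≤ 2} =
      {ω : BondConfig (Fin n) | 2 * (A.filter fun x => ω ∈ openConn a x).card ≤ A.card} := by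
  ext ω
  simp only [Set.mem_setOf_eq, hA]
  omega

/-- **`CIL₂(5)` from the lightest-relay transfer at `|A| = 5`.**  If for every weighted graph, every five-element relay
set `A`, every observer `o ∉ A` and every relay `a ∈ A` maximising `μ(light a)` one has
`μ(o ↮ a, o ↔ A∖a, light o) ≤ μ(o ↮ a, light a)`, then `OneCutFive.CIL25`
(gen-induct's `lightestRelayTransfer_imp_cumulativeIsolation`, instance `A.card = 5`). [this work] -/
theorem cil25_of_lightestRelayTransfer5
    (hLRT : ∀ (n : ℕ) (w : Sym2 (Fin n) → unitInterval) (A : Finset (Fin n)) (o a : Fin n),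
      A.card = 5 → a ∈ A → o ∉ A →
      (∀ g ∈ A, (prodBernoulli w).real {ω : BondConfig (Fin n) |
          2 * (A.filter fun x => ω ∈ openConn g x).card ≤ A.card} ≤
        (prodBernoulli w).real {ω : BondConfig (Fin n) |
          2 * (A.filter fun x => ω ∈ openConn a x).card ≤ A.card}) →
      (prodBernoulli w).real ({ω : BondConfig (Fin n) | ¬ (openGraph ω).Reachable o a} ∩
          {ω | ∃ g ∈ A, g ≠ a ∧ (openGraph ω).Reachable o g} ∩
          {ω | 2 * (A.filter fun x => ω ∈ openConn o x).card ≤ A.card}) ≤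
        (prodBernoulli w).real ({ω : BondConfig (Fin n) | ¬ (openGraph ω).Reachable o a} ∩
          {ω | 2 * (A.filter fun x => ω ∈ openConn a x).card ≤ A.card})) :
    CIL25 := by
  intro n w A o hA ho
  have hne : A.Nonempty := Finset.card_pos.1 (by omega)
  obtain ⟨a, ha, hmax⟩ := Finset.exists_max_image A
    (fun g => (prodBernoulli w).real {ω : BondConfig (Fin n) |
      2 * (A.filter fun x => ω ∈ openConn g x).card ≤ A.card}) hne
  refine ⟨a, ha, ?_⟩
  have h := AnchoredUnionTransfer.lightestRelayTransfer_imp_cumulativeIsolation w A o a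
    (hLRT n w A o a hA ha ho hmax)
  rw [minority_set_eq_of_card_five A o hA, light_set_eq_of_card_five A a hA]
  exact h

/-- **`CIL₂(5)` from the anchored union transfer `AUT(|W| = 4)`**: the same with the right-hand side
`μ(o ↮ a, o ↔ A∖a, light a)` (which is at most `μ(o ↮ a, light a)`). [this work] -/
theorem cil25_of_anchoredUnionTransfer5
    (hAUT : ∀ (n : ℕ) (w : Sym2 (Fin n) → unitInterval) (A : Finset (Fin n)) (o a : Fin n),
      A.card = 5 → a ∈ A → o ∉ A →
      (∀ g ∈ A, (prodBernoulli w).real {ω : BondConfig (Fin n) |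
          2 * (A.filter fun x => ω ∈ openConn g x).card ≤ A.card} ≤
        (prodBernoulli w).real {ω : BondConfig (Fin n) |
          2 * (A.filter fun x => ω ∈ openConn a x).card ≤ A.card}) →
      (prodBernoulli w).real ({ω : BondConfig (Fin n) | ¬ (openGraph ω).Reachable o a} ∩
          {ω | ∃ g ∈ A, g ≠ a ∧ (openGraph ω).Reachable o g} ∩
          {ω | 2 * (A.filter fun x => ω ∈ openConn o x).card ≤ A.card}) ≤
        (prodBernoulli w).real ({ω : BondConfig (Fin n) | ¬ (openGraph ω).Reachable o a} ∩
          {ω | ∃ g ∈ A, g ≠ a ∧ (openGraph ω).Reachable o g} ∩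
          {ω | 2 * (A.filter fun x => ω ∈ openConn a x).card ≤ A.card})) :
    CIL25 := by
  refine cil25_of_lightestRelayTransfer5 fun n w A o a hA ha ho hmax => ?_
  refine (hAUT n w A o a hA ha ho hmax).trans (measureReal_mono ?_ (measure_ne_top _ _))
  rintro ω ⟨⟨hoa, _⟩, hl⟩
  exact ⟨hoa, hl⟩

/-- **`X′(5) ∧ AUT(|W| = 4) ⟹ oneCut(5)`** (assembly-1's `oneCut5_of_twoFingerHub_of_cil25` with `CIL₂(5)` supplied by the
anchored union transfer). [this work] -/
theorem oneCut5_of_twoFingerHub_of_anchoredUnionTransfer5 (hX : TwoFingerHub)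
    (hAUT : ∀ (n : ℕ) (w : Sym2 (Fin n) → unitInterval) (A : Finset (Fin n)) (o a : Fin n),
      A.card = 5 → a ∈ A → o ∉ A →
      (∀ g ∈ A, (prodBernoulli w).real {ω : BondConfig (Fin n) |
          2 * (A.filter fun x => ω ∈ openConn g x).card ≤ A.card} ≤
        (prodBernoulli w).real {ω : BondConfig (Fin n) |
          2 * (A.filter fun x => ω ∈ openConn a x).card ≤ A.card}) →
      (prodBernoulli w).real ({ω : BondConfig (Fin n) | ¬ (openGraph ω).Reachable o a} ∩
          {ω | ∃ g ∈ A, g ≠ a ∧ (openGraph ω).Reachable o g} ∩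
          {ω | 2 * (A.filter fun x => ω ∈ openConn o x).card ≤ A.card}) ≤
        (prodBernoulli w).real ({ω : BondConfig (Fin n) | ¬ (openGraph ω).Reachable o a} ∩
          {ω | ∃ g ∈ A, g ≠ a ∧ (openGraph ω).Reachable o g} ∩
          {ω | 2 * (A.filter fun x => ω ∈ openConn a x).card ≤ A.card})) :
    OneCut5 :=
  oneCut5_of_twoFingerHub_of_cil25 hX (cil25_of_anchoredUnionTransfer5 hAUT)

/-- **The `|A| = 5` rung from the three open pieces**: `Z(3,2)` (four points; gives the `o ∈ A` half,
`oneCut5_at_of_mem_of_zeroOneThree`), `CIL₂(5)`, and the two-finger bound at relays for observers OFF the relay set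
(`X′_off`: for `o ∉ A` with `E N > 4`, every relay `a` and every `t ≥ 0` bounding all relay–relay cuts, `μ{#T_a ≤ 2} ≤ t`).
Case `E N ≤ 4` is the tree's `oneCut_of_sum_le_four`. [this work] -/
theorem oneCut5_of_zeroOneThree_of_cil25_of_twoFingerOff (hZ : ZeroOneThree) (hC : CIL25)
    (hXoff : ∀ (n : ℕ) (w : Sym2 (Fin n) → unitInterval) (A : Finset (Fin n)) (o : Fin n), A.card = 5 → o ∉ A →
      4 < ∑ x ∈ A, (prodBernoulli w).real (openConn o x) →
      ∀ a ∈ A, ∀ t : ℝ, 0 ≤ t → (∀ b ∈ A, ∀ b' ∈ A, b ≠ b' → (prodBernoulli w).real (openConn b b')ᶜ ≤ t) →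
        (prodBernoulli w).real {ω : BondConfig (Fin n) | (A.filter fun x => ω ∈ openConn a x).card ≤ 2} ≤ t) :
    OneCut5 := by
  intro n w A o t hA ht hcut
  by_cases ho : o ∈ A
  · exact oneCut5_at_of_mem_of_zeroOneThree hZ w A o t hA ho ht hcut
  by_cases hEN : (∑ x ∈ A, (prodBernoulli w).real (openConn o x)) ≤ 4
  · exact oneCut_of_sum_le_four n w A o t hEN ht hcut
  · have hEN' : 4 < ∑ x ∈ A, (prodBernoulli w).real (openConn o x) := lt_of_not_ge hEN
    obtain ⟨a, ha, hle⟩ := hC n w A o hA ho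
    calc (prodBernoulli w).real {ω : BondConfig (Fin n) | 1 ≤ (A.filter fun a => ω ∈ openConn o a).card ∧
            ((A.filter fun a => ω ∈ openConn o a).card : ℝ) < (∑ a ∈ A, (prodBernoulli w).real (openConn o a)) / 2}
        ≤ (prodBernoulli w).real {ω : BondConfig (Fin n) | 1 ≤ (A.filter fun x => ω ∈ openConn o x).card ∧
            (A.filter fun x => ω ∈ openConn o x).card ≤ 2} := measureReal_mono (minority_subset_le_two w A o hA)
      _ ≤ (prodBernoulli w).real {ω : BondConfig (Fin n) | (A.filter fun x => ω ∈ openConn a x).card ≤ 2} := hle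
      _ ≤ t := hXoff n w A o hA ho hEN' a ha t ht hcut

end OneCutFive

end Summit.CriticalPhenomena.PercolationContinuityZ3.Theorems

end
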